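import Mathlib
import HarnessLib
import Summits.NavierStokesRegularity.NavierStokesRegularity.Theorems.TaylorModelRungThreeReadoutVTubeDeriv
import Summits.NavierStokesRegularity.NavierStokesRegularity.Theorems.TaylorModelRungThreeReadoutVCrossing
import Summits.NavierStokesRegularity.NavierStokesRegularity.Theorems.TaylorModelRungThreeReadoutVNodes
import Summits.NavierStokesRegularity.NavierStokesRegularity.Theorems.TaylorModelRungThreeReadoutFlowPackageV

/-!
# Line `taylor-model` on crux K1b-DR (stmt-NavierStokesRegularity-23954) — v3 G-side assembly: K1b-DR's DYNAMIC
# block from `ValidV`, and the crux modulo the landing block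

Composition of G1-v (`polyInvariantV`), G2-v (`kBlockE1_crossing_ofV`) and G3-v (`kBlockTubeLip_ofV`): for a v3
certificate `ValidV cd bx rd ro` and a flow package `IsFlowPackageV cd bx φ` (e.g. the selector flow, by
`isFlowPackageV_of_core`), K1b-DR's dynamic block `KBlockDyn cd φ (tauSel cd φ)` holds.  With the landing block
`KBlockLand` (G4-v, the face-wise C¹ read-out — not in this file) `k1bDR_of_blocks` then gives the crux; the last
theorem states exactly that remaining implication for the selector flow.

* `kBlockDynV` — `ValidV → IsFlowPackageV → KBlockDyn cd φ (tauSel cd φ)`;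
* `k1bDR_of_validV_of_land` — `ValidV → KBlockLand cd φsel (tauSel cd φsel) → DerivativeEnclosureCertificateR`
  for the selector flow `φsel := liftFlow cd (flowSel (Qw cd))`.

MODEL-lattice rung TL-M3 only; nothing here is a statement about the Navier–Stokes equations (K1b-DR is a
model-rung certificate statement; it is NOT proved here — the landing block is outstanding).
-/

noncomputable section

-- the sub-problem namespace repeats the summit name by design (D-0017)
set_option linter.dupNamespace false

namespace Summit.NavierStokesRegularity.NavierStokesRegularity.Theorems.TaylorModelV

open Set
open Literature.Analysis.FluidPDE.TaoCascade Literature.Analysis.FluidPDE.TaoCascade.TaylorChain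
open Summit.NavierStokesRegularity.NavierStokesRegularity.Theorems.TaylorModelMajorant
open Summit.NavierStokesRegularity.NavierStokesRegularity.Theorems.TaylorModelReadout

variable {cd : CertData} {bx : StepBoxes} {rd : RadiiData} {ro : ReadoutData} {φ : Flow}

/-- **K1b-DR's dynamic block from a v3 certificate and a v3 flow package** (crossing time = `tauSel`). [folklore] -/
theorem kBlockDynV (hV : ValidV cd bx rd ro) (hF : IsFlowPackageV cd bx φ) : KBlockDyn cd φ (tauSel cd φ) := by
  obtain ⟨hS, hSN, ⟨hC, hR⟩, hRO⟩ := hV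
  have hwin : -cd.Kb ≤ cd.Ka := by
    have hKb : 0 ≤ cd.Kb := hS.2.2.2.2.2.2.2.2.2.2.1
    have hKa : 1 ≤ cd.Ka := hS.2.2.2.2.2.2.2.2.2.2.2.1
    linarith
  have hPN := (polyInvariantV hC hR hF).1
  obtain ⟨hE1, hτ⟩ := kBlockE1_crossing_ofV hSN hC hF hRO hPN
  obtain ⟨hT, hL⟩ := kBlockTubeLip_ofV hSN hC hF hRO hwin hPN hτ
  exact kBlockDyn_of cd φ _ hE1 hT hL

/-- **K1b-DR modulo the landing block**: a v3 certificate plus the landing block `KBlockLand` for the SELECTOR flow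
(at the crossing time `tauSel`) give `DerivativeEnclosureCertificateR`. [folklore] -/
theorem k1bDR_of_validV_of_land (hV : ValidV cd bx rd ro)
    (hL : KBlockLand cd (fun _ => liftFlow cd (fun x s => flowSel (Qw cd) x s))
      (tauSel cd (fun _ => liftFlow cd (fun x s => flowSel (Qw cd) x s)))) :
    Summit.NavierStokesRegularity.NavierStokesRegularity.Theses.ExactWindowRungThree.DerivativeEnclosureCertificateR := by
  have hF : IsFlowPackageV cd bx (fun _ => liftFlow cd (fun x s => flowSel (Qw cd) x s)) :=
    isFlowPackageV_of_core hV.2.1 hV.2.2.1.1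
  exact k1bDR_of_blocks cd hV.1 hV.2.1 _ _ (kBlockDynV hV hF) hL

end Summit.NavierStokesRegularity.NavierStokesRegularity.Theorems.TaylorModelV

end
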